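import Summits.HodgeConjecture.HodgeConjecture.Theorems.Ring2WeilCoverageNormClassEq
import Summits.HodgeConjecture.HodgeConjecture.Theorems.Ring2WeilCoverageNormTableC
import HarnessLib

/-!
# Weil-type family coverage — product windows, part U: three NEW rows by CONSTRUCTIVE realisation — `W6.2.65 = (3, ℚ(√-2), [65])`, `W6.7.39 = (3, ℚ(√-7), [39])`, `W6.7.51 = (3, ℚ(√-7), [51])` — and the pillowcase polygons `n = 391` (`ℚ(√-3)`) / `n = 437` (`ℚ(i)`)

research route conditional on HC_CM; not a corollary; Q11.4-sentence-2 already refuted in dim ≥ 3.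

Ring 2, WEIL-TYPE FAMILY-COVERAGE CENSUS (`HOME/WEIL-FAMILY-COVERAGE.md` `## b04`, block b04.15 P.S. 7, owner ring2-b04, gen 51); twenty-first part of
`Ring2WeilCoverageProductWindow` (same conventions as parts L–T).  NEW in this part: the generic carrier scan's near-regular cycle-type data
(e.g. `GL₂(3) × S₆₅` `(3:3²¹.2, 2:2²⁹.1⁷, 8a:8⁸.1)`, centralisers ~ `10¹¹`, where random realisation is hopeless — kit j206874: `0/3·10⁷` hits) are
realised CONSTRUCTIVELY: `planmap.py` fixes the long-cycle permutation `z`, builds the involution `y` dart by dart and forces every maximal path of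
`x = z⁻¹y` of the largest available length to close (depth-first search with propagation = a search over planar hypermaps of the prescribed type;
25–10⁴ nodes per datum), and the engine's dense cohomology is replaced by the sparse `fastcover.py` (spanning tree / dual spanning tree: the `2g`
leftover edges give the fundamental cycles and, by peeling the dual tree, the dual cocycles; validated on `W6.2.23` and `W6.7.17`: same classes).
§1 `W6.2.65` (pub-hsemireg R4, `ℚ(√-2)`, `a = 65`, `T = {5,13}`): `GL₂(3) × S₆₅` `(3:3²¹.2, 2:2²⁹.1⁷, 8a:8⁸.1)` (`Y` genus 34, 1 560 sheets;
kit j209497) `det H = -1/126360` and `GL₂(3) × A₆₅` `(3:3²¹.1², 2:2³⁰.1⁵, 8a:8⁸.1)` (`Y` genus 31) `-113/336960`.  §2 `W6.7.39` (`ℚ(√-7)`,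
`a = 39`, `T = {3,13}`): `PSL₂(7) × S₃₉` `(2:2¹⁷.1⁵, 3:3¹³, 7a:7⁵.4)`, `(2:2¹⁸.1³, 3:3¹².2.1, 7a:7⁵.4)`, `(2:2¹⁹.1, 3:3¹¹.2².1², 7a:7⁵.4)` (`Y` genus
39 / 47 / 55, 2 184 sheets; kit j209498): `-379/107016`, `-113/122304`, `-356323/13698048`.  §3 `W6.7.51` (`a = 51`, `T = {3,17}`):
`PSL₂(7) × S₅₁` `(2:2²³.1⁵, 3:3¹⁷, 7a:7⁷.2)`, `(2:2²⁴.1³, 3:3¹⁶.2.1, 7a:7⁷.2)`, `(2:2²⁵.1, 3:3¹⁵.2².1², 7a:7⁷.2)` (`Y` genus 39 / 47 / 55, 2 856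
sheets; kit j209499): `-967/279888`, `-53/39984`, `-11289/11941888`.  All nine: `(3,3)` WEIL TYPE, class `[n]` = THEOREM S7/S8's `[n]^{r₁}`
(`r₁ = 1`).  §4 the uniform pillowcase polygons (THEOREM S10) `n = 391 = 17·23` over `ℚ(√-3)` (`det H = -64/391`, `T = {17,23}`, 1 173 sheets)
and `n = 437 = 19·23` over `ℚ(i)` (`-1/437`, `T = {19,23}`, 1 748 sheets), with the single-representative reductions `391 ∉ Nm(ℚ(√-3)ˣ)`
(inert prime 17) and `437 ∉ Nm(ℚ(i)ˣ)` (inert prime 19).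

No `def`, no named fact, no `sorry`; nothing here is a statement about Hodge classes; `HC_CM` is used nowhere.
References: [cite: vanGeemen1994HodgeAV, (5.4.1), Lemma 5.2]; [cite: Serre1973, Ch. III §1].
-/

set_option linter.dupNamespace false

open Literature.AlgebraicGeometry.Motives
open Literature.AlgebraicGeometry.VanGeemen1994
open Summit.HodgeConjecture.HodgeConjecture.Ring2.Hypotheses

namespace Summit.HodgeConjecture.HodgeConjecture.Ring2.WeilCoverage

namespace SqrtNeg3

/-- `391 ∉ Nm(ℚ(√-3)ˣ)`: descent at the inert prime `17` (`-3` is a non-square mod `17`, `17 ∥ 391 = 17·23`); `T(391) = {17, 23}` — the row key of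
`W6.3.391`. research route conditional on HC_CM; not a corollary; Q11.4-sentence-2 already refuted in dim ≥ 3. [cite: Serre1973, Ch. III §1] -/
theorem not_mem_391 : Units.mk0 (391 : ℚ) (by norm_num) ∉ normUnitsSubgroup ℚ (weilField 3) := by
  simpa using natCast_not_mem_normUnitsSubgroup_of_inert (d := 3) (a := 391) (p := 17)
    (by norm_num) (by decide) (by norm_num) (by norm_num) (by norm_num)

end SqrtNeg3

namespace SqrtNeg1

/-- `437 ∉ Nm(ℚ(i)ˣ)`: descent at the inert prime `19 ≡ 3 (mod 4)` (`19 ∥ 437 = 19·23`); `T(437) = {19, 23}` — the row key of `W6.1.437`.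
research route conditional on HC_CM; not a corollary; Q11.4-sentence-2 already refuted in dim ≥ 3. [cite: Serre1973, Ch. III §1] -/
theorem not_mem_437 : Units.mk0 (437 : ℚ) (by norm_num) ∉ normUnitsSubgroup ℚ (weilField 1) := by
  simpa using natCast_not_mem_normUnitsSubgroup_of_inert (d := 1) (a := 437) (p := 19)
    (by norm_num) (by decide) (by norm_num) (by norm_num) (by norm_num)

end SqrtNeg1

/-! ### §1 `W6.2.65 = (3, ℚ(√-2), [65])`: `GL₂(3) × S₆₅ / A₆₅`, constructive realisation -/

/-- FIBRE-PRODUCT datum `GL23xS65` `(0; 3:3^21.2,2:2^29.1^7,8a:8^8.1)` (cycle types in `S65`; Hurwitz dimension 0; CONSTRUCTED by depth-first search on planar hypermaps of the prescribed type (`planmap.py`; the random search fails on near-regular cycle types), then certified: generation: 2-transitive + Jordan (a 2-cycle as the 3-th power of a branch cycle, 2 <= n-3) => monodromy >= A_65): `Y = D ×_{ℙ¹} X` (genus 34; `D` the `GL23`-quotient datum = the `H₁`-quotient of the `GL23`-curve `C̃/S65`, `X` the degree-65 cover, genus 0), computed on its 1560 sheets (engine `bigwin.py` with the sparse cohomology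 `fastcover.py`, exact); the HIDDEN FACTOR `B` = the `λ`-part of the Prym `P(Y/D)` — an abelian SIXFOLD with `(3,3)` `ℚ(√-2)`-action, WEIL TYPE — has literal `det H|_B = -1/126360`, `a = 1/126360`, `T(a) = [5, 13]`: row `W6.2.65` (NON-split); `r₁ = dim_K H¹(D)_λ = 1`, `r_H = 7`. THEOREM S8 (Prym form of the product-window law, census b04.15 (A): `[a_B] = [n]^{r₁}`, no 2-transitivity needed) predicts `T(a_B) = [5, 13]` from `r₁ = 1`, `n = 65` — CONFIRMED.
research route conditional on HC_CM; not a corollary; Q11.4-sentence-2 already refuted in dim ≥ 3. [cite: vanGeemen1994HodgeAV, (5.4.1)] -/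
theorem fibre2_GL23S65_n65_c87ba2_mk_detH_ne_split :
    (QuotientGroup.mk (Units.mk0 (((-1 : ℚ) / 126360)) (by norm_num)) : weilNormResidueGroup 2) ≠
      splitDiscriminantClass 3 2 := by
  have e : Units.mk0 (((-1 : ℚ) / 126360)) (by norm_num) = -(Units.mk0 ((1 : ℚ) / 126360) (by norm_num)) := Units.ext (by norm_num)
  rw [Ne, e, mk_neg_eq_splitDiscriminantClass_iff_of_odd (n := 3) (by decide)]
  have h := mul_not_mem_normUnitsSubgroup (mem_normUnitsSubgroup_of_sq_add_mul_sq (d := 2) (a := ((1 : ℚ) / 8213400)) (by norm_num) ((-1 : ℚ) / 3510) ((1 : ℚ) / 7020) (by norm_num))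
    Summit.HodgeConjecture.HodgeConjecture.Ring2.WeilCoverage.SqrtNeg2.not_mem_65
  rw [mk0_mul_mk0] at h
  norm_num at h
  exact h

/-- The same datum, CELL IDENTIFICATION: `[det H|_B] = [-65]` in `ℚˣ/Nm(ℚ(√-2)ˣ)` — the census ROW KEY of `W6.2.65` (`a·65 = ((1 : ℚ) / 1944) = (((-1 : ℚ) / 54))² + 2·(((1 : ℚ) / 108))²`).
research route conditional on HC_CM; not a corollary; Q11.4-sentence-2 already refuted in dim ≥ 3. [cite: vanGeemen1994HodgeAV, Lemma 5.2 (3)] -/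
theorem fibre2_GL23S65_n65_c87ba2_mk_detH_eq_key :
    (QuotientGroup.mk (Units.mk0 (-(((1 : ℚ) / 126360))) (neg_ne_zero.2 (by norm_num))) : weilNormResidueGroup 2) =
      QuotientGroup.mk (Units.mk0 (-(65 : ℚ)) (neg_ne_zero.2 (by norm_num))) :=
  mk_neg_eq_mk_neg_of_mul_mem (by norm_num) (by norm_num)
    (mem_normUnitsSubgroup_of_sq_add_mul_sq _ ((-1 : ℚ) / 54) ((1 : ℚ) / 108) (by norm_num))

/-- FIBRE-PRODUCT datum `GL23xA65` `(0; 3:3^21.1^2,2:2^30.1^5,8a:8^8.1)` (cycle types in `A65`; Hurwitz dimension 0; CONSTRUCTED by depth-first search on planar hypermaps of the prescribed type (`planmap.py`; the random search fails on near-regular cycle types), then certified: generation: 2-transitive + Jordan (a random word of the branch cycles has a single 61-cycle, 61 prime, n/2 < 61 <= n-3): `Y = D ×_{ℙ¹} X` (genus 31; `D` the `GL23`-quotient datum = the `H₁`-quotient of the `GL23`-curve `C̃/A65`, `X` the degree-65 cover, genus 0), computed on its 1560 sheets (engine `bigwin.py` with the sparse cohomology `fastcover.py`, exact); the HIDDEN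 FACTOR `B` = the `λ`-part of the Prym `P(Y/D)` — an abelian SIXFOLD with `(3,3)` `ℚ(√-2)`-action, WEIL TYPE — has literal `det H|_B = -113/336960`, `a = 113/336960`, `T(a) = [5, 13]`: row `W6.2.65` (NON-split); `r₁ = dim_K H¹(D)_λ = 1`, `r_H = 7`. THEOREM S8 (Prym form of the product-window law, census b04.15 (A): `[a_B] = [n]^{r₁}`, no 2-transitivity needed) predicts `T(a_B) = [5, 13]` from `r₁ = 1`, `n = 65` — CONFIRMED.
research route conditional on HC_CM; not a corollary; Q11.4-sentence-2 already refuted in dim ≥ 3. [cite: vanGeemen1994HodgeAV, (5.4.1)] -/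
theorem fibre2_GL23A65_n65_7fd576_mk_detH_ne_split :
    (QuotientGroup.mk (Units.mk0 (((-113 : ℚ) / 336960)) (by norm_num)) : weilNormResidueGroup 2) ≠
      splitDiscriminantClass 3 2 := by
  have e : Units.mk0 (((-113 : ℚ) / 336960)) (by norm_num) = -(Units.mk0 ((113 : ℚ) / 336960) (by norm_num)) := Units.ext (by norm_num)
  rw [Ne, e, mk_neg_eq_splitDiscriminantClass_iff_of_odd (n := 3) (by decide)]
  have h := mul_not_mem_normUnitsSubgroup (mem_normUnitsSubgroup_of_sq_add_mul_sq (d := 2) (a := ((113 : ℚ) / 21902400)) (by norm_num) ((1 : ℚ) / 520) ((1 : ℚ) / 1170) (by norm_num))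
    Summit.HodgeConjecture.HodgeConjecture.Ring2.WeilCoverage.SqrtNeg2.not_mem_65
  rw [mk0_mul_mk0] at h
  norm_num at h
  exact h

/-- The same datum, CELL IDENTIFICATION: `[det H|_B] = [-65]` in `ℚˣ/Nm(ℚ(√-2)ˣ)` — the census ROW KEY of `W6.2.65` (`a·65 = ((113 : ℚ) / 5184) = (((1 : ℚ) / 8))² + 2·(((1 : ℚ) / 18))²`).
research route conditional on HC_CM; not a corollary; Q11.4-sentence-2 already refuted in dim ≥ 3. [cite: vanGeemen1994HodgeAV, Lemma 5.2 (3)] -/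
theorem fibre2_GL23A65_n65_7fd576_mk_detH_eq_key :
    (QuotientGroup.mk (Units.mk0 (-(((113 : ℚ) / 336960))) (neg_ne_zero.2 (by norm_num))) : weilNormResidueGroup 2) =
      QuotientGroup.mk (Units.mk0 (-(65 : ℚ)) (neg_ne_zero.2 (by norm_num))) :=
  mk_neg_eq_mk_neg_of_mul_mem (by norm_num) (by norm_num)
    (mem_normUnitsSubgroup_of_sq_add_mul_sq _ ((1 : ℚ) / 8) ((1 : ℚ) / 18) (by norm_num))

/-! ### §2–§3 `W6.7.39` and `W6.7.51`: `PSL₂(7) × S₃₉ / S₅₁`, constructive realisation -/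

/-- FIBRE-PRODUCT datum `L27cxS39` `(0; 2:2^17.1^5,3:3^13,7a:7^5.4)` (cycle types in `S39`; Hurwitz dimension 0; CONSTRUCTED by depth-first search on planar hypermaps of the prescribed type (`planmap.py`; the random search fails on near-regular cycle types), then certified: generation: 2-transitive + Jordan (a random word of the branch cycles has a single 31-cycle, 31 prime, n/2 < 31 <= n-3): `Y = D ×_{ℙ¹} X` (genus 39; `D` the `L27c`-quotient datum = the `H₁`-quotient of the `L27c`-curve `C̃/S39`, `X` the degree-39 cover, genus 0), computed on its 2184 sheets (engine `bigwin.py` with the sparse cohomology `fastcover.py`, exact); the HIDDEN FACTOR `B` = the `λ`-part of the Prym `P(Y/D)` — an abelian SIXFOLD with `(3,3)` `ℚ(√-7)`-action, WEIL TYPE — has literal `det H|_B = -379/107016`, `a = 379/107016`, `T(a) = [3, 13]`: row `W6.7.39` (NON-split); `r₁ = dim_K H¹(D)_λ = 1`, `r_H = 7`. THEOREM S8 (Prym form of the product-window law, census b04.15 (A): `[a_B] = [n]^{r₁}`, no 2-transitivity needed) predicts `T(a_B) = [3, 13]` from `r₁ = 1`, `n = 39` — CONFIRMED.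
research route conditional on HC_CM; not a corollary; Q11.4-sentence-2 already refuted in dim ≥ 3. [cite: vanGeemen1994HodgeAV, (5.4.1)] -/
theorem fibre7_L27cS39_n39_f1ad9b_mk_detH_ne_split :
    (QuotientGroup.mk (Units.mk0 (((-379 : ℚ) / 107016)) (by norm_num)) : weilNormResidueGroup 7) ≠
      splitDiscriminantClass 3 7 := by
  have e : Units.mk0 (((-379 : ℚ) / 107016)) (by norm_num) = -(Units.mk0 ((379 : ℚ) / 107016) (by norm_num)) := Units.ext (by norm_num)
  rw [Ne, e, mk_neg_eq_splitDiscriminantClass_iff_of_odd (n := 3) (by decide)]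
  have h := mul_not_mem_normUnitsSubgroup (mem_normUnitsSubgroup_of_sq_add_mul_sq (d := 7) (a := ((379 : ℚ) / 4173624)) (by norm_num) ((-1 : ℚ) / 168) ((-43 : ℚ) / 15288) (by norm_num))
    Summit.HodgeConjecture.HodgeConjecture.Ring2.WeilCoverage.SqrtNeg7.not_mem_39
  rw [mk0_mul_mk0] at h
  norm_num at h
  exact h

/-- The same datum, CELL IDENTIFICATION: `[det H|_B] = [-39]` in `ℚˣ/Nm(ℚ(√-7)ˣ)` — the census ROW KEY of `W6.7.39` (`a·39 = ((379 : ℚ) / 2744) = (((-13 : ℚ) / 56))² + 7·(((-43 : ℚ) / 392))²`).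
research route conditional on HC_CM; not a corollary; Q11.4-sentence-2 already refuted in dim ≥ 3. [cite: vanGeemen1994HodgeAV, Lemma 5.2 (3)] -/
theorem fibre7_L27cS39_n39_f1ad9b_mk_detH_eq_key :
    (QuotientGroup.mk (Units.mk0 (-(((379 : ℚ) / 107016))) (neg_ne_zero.2 (by norm_num))) : weilNormResidueGroup 7) =
      QuotientGroup.mk (Units.mk0 (-(39 : ℚ)) (neg_ne_zero.2 (by norm_num))) :=
  mk_neg_eq_mk_neg_of_mul_mem (by norm_num) (by norm_num)
    (mem_normUnitsSubgroup_of_sq_add_mul_sq _ ((-13 : ℚ) / 56) ((-43 : ℚ) / 392) (by norm_num))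

/-- FIBRE-PRODUCT datum `L27cxS39` `(0; 2:2^18.1^3,3:3^12.2.1,7a:7^5.4)` (cycle types in `S39`; Hurwitz dimension 0; CONSTRUCTED by depth-first search on planar hypermaps of the prescribed type (`planmap.py`; the random search fails on near-regular cycle types), then certified: generation: 2-transitive + Jordan (a 2-cycle as the 3-th power of a branch cycle, 2 <= n-3) => monodromy >= A_39): `Y = D ×_{ℙ¹} X` (genus 47; `D` the `L27c`-quotient datum = the `H₁`-quotient of the `L27c`-curve `C̃/S39`, `X` the degree-39 cover, genus 0), computed on its 2184 sheets (engine `bigwin.py` with the sparse cohomology `fastcover.py`, exact); the HIDDEN FACTOR `B` = the `λ`-part of the Prym `P(Y/D)` — an abelian SIXFOLD with `(3,3)` `ℚ(√-7)`-action, WEIL TYPE — has literal `det H|_B = -113/122304`, `a = 113/122304`, `T(a) = [3, 13]`: row `W6.7.39` (NON-split); `r₁ = dim_K H¹(D)_λ = 1`, `r_H = 7`. THEOREM S8 (Prym form of the product-window law, census b04.15 (A): `[a_B] = [n]^{r₁}`, no 2-transitivity needed) predicts `T(a_B) = [3, 13]` from `r₁ = 1`, `n = 39` — CONFIRMED.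
research route conditional on HC_CM; not a corollary; Q11.4-sentence-2 already refuted in dim ≥ 3. [cite: vanGeemen1994HodgeAV, (5.4.1)] -/
theorem fibre7_L27cS39_n39_73bcbc_mk_detH_ne_split :
    (QuotientGroup.mk (Units.mk0 (((-113 : ℚ) / 122304)) (by norm_num)) : weilNormResidueGroup 7) ≠
      splitDiscriminantClass 3 7 := by
  have e : Units.mk0 (((-113 : ℚ) / 122304)) (by norm_num) = -(Units.mk0 ((113 : ℚ) / 122304) (by norm_num)) := Units.ext (by norm_num)
  rw [Ne, e, mk_neg_eq_splitDiscriminantClass_iff_of_odd (n := 3) (by decide)]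
  have h := mul_not_mem_normUnitsSubgroup (mem_normUnitsSubgroup_of_sq_add_mul_sq (d := 7) (a := ((113 : ℚ) / 4769856)) (by norm_num) ((1 : ℚ) / 2184) ((1 : ℚ) / 546) (by norm_num))
    Summit.HodgeConjecture.HodgeConjecture.Ring2.WeilCoverage.SqrtNeg7.not_mem_39
  rw [mk0_mul_mk0] at h
  norm_num at h
  exact h

/-- The same datum, CELL IDENTIFICATION: `[det H|_B] = [-39]` in `ℚˣ/Nm(ℚ(√-7)ˣ)` — the census ROW KEY of `W6.7.39` (`a·39 = ((113 : ℚ) / 3136) = (((1 : ℚ) / 56))² + 7·(((1 : ℚ) / 14))²`).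
research route conditional on HC_CM; not a corollary; Q11.4-sentence-2 already refuted in dim ≥ 3. [cite: vanGeemen1994HodgeAV, Lemma 5.2 (3)] -/
theorem fibre7_L27cS39_n39_73bcbc_mk_detH_eq_key :
    (QuotientGroup.mk (Units.mk0 (-(((113 : ℚ) / 122304))) (neg_ne_zero.2 (by norm_num))) : weilNormResidueGroup 7) =
      QuotientGroup.mk (Units.mk0 (-(39 : ℚ)) (neg_ne_zero.2 (by norm_num))) :=
  mk_neg_eq_mk_neg_of_mul_mem (by norm_num) (by norm_num)
    (mem_normUnitsSubgroup_of_sq_add_mul_sq _ ((1 : ℚ) / 56) ((1 : ℚ) / 14) (by norm_num))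

/-- FIBRE-PRODUCT datum `L27cxS39` `(0; 2:2^19.1,3:3^11.2^2.1^2,7a:7^5.4)` (cycle types in `S39`; Hurwitz dimension 0; CONSTRUCTED by depth-first search on planar hypermaps of the prescribed type (`planmap.py`; the random search fails on near-regular cycle types), then certified: generation: 2-transitive + Jordan (a random word of the branch cycles has a single 23-cycle, 23 prime, n/2 < 23 <= n-3): `Y = D ×_{ℙ¹} X` (genus 55; `D` the `L27c`-quotient datum = the `H₁`-quotient of the `L27c`-curve `C̃/S39`, `X` the degree-39 cover, genus 0), computed on its 2184 sheets (engine `bigwin.py` with the sparse cohomology `fastcover.py`, exact); the HIDDEN FACTOR `B` = the `λ`-part of the Prym `P(Y/D)` — an abelian SIXFOLD with `(3,3)` `ℚ(√-7)`-action, WEIL TYPE — has literal `det H|_B = -356323/13698048`, `a = 356323/13698048`, `T(a) = [3, 13]`: row `W6.7.39` (NON-split); `r₁ = dim_K H¹(D)_λ = 1`, `r_H = 7`. THEOREM S8 (Prym form of the product-window law, census b04.15 (A): `[a_B] = [n]^{r₁}`, no 2-transitivity needed) predicts `T(a_B) = [3, 13]` from `r₁ = 1`, `n = 39` — CONFIR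MED.
research route conditional on HC_CM; not a corollary; Q11.4-sentence-2 already refuted in dim ≥ 3. [cite: vanGeemen1994HodgeAV, (5.4.1)] -/
theorem fibre7_L27cS39_n39_68d86a_mk_detH_ne_split :
    (QuotientGroup.mk (Units.mk0 (((-356323 : ℚ) / 13698048)) (by norm_num)) : weilNormResidueGroup 7) ≠
      splitDiscriminantClass 3 7 := by
  have e : Units.mk0 (((-356323 : ℚ) / 13698048)) (by norm_num) = -(Units.mk0 ((356323 : ℚ) / 13698048) (by norm_num)) := Units.ext (by norm_num)
  rw [Ne, e, mk_neg_eq_splitDiscriminantClass_iff_of_odd (n := 3) (by decide)]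
  have h := mul_not_mem_normUnitsSubgroup (mem_normUnitsSubgroup_of_sq_add_mul_sq (d := 7) (a := ((356323 : ℚ) / 534223872)) (by norm_num) ((-47 : ℚ) / 2912) ((-233 : ℚ) / 30576) (by norm_num))
    Summit.HodgeConjecture.HodgeConjecture.Ring2.WeilCoverage.SqrtNeg7.not_mem_39
  rw [mk0_mul_mk0] at h
  norm_num at h
  exact h

/-- The same datum, CELL IDENTIFICATION: `[det H|_B] = [-39]` in `ℚˣ/Nm(ℚ(√-7)ˣ)` — the census ROW KEY of `W6.7.39` (`a·39 = ((356323 : ℚ) / 351232) = (((-141 : ℚ) / 224))² + 7·(((-233 : ℚ) / 784))²`).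
research route conditional on HC_CM; not a corollary; Q11.4-sentence-2 already refuted in dim ≥ 3. [cite: vanGeemen1994HodgeAV, Lemma 5.2 (3)] -/
theorem fibre7_L27cS39_n39_68d86a_mk_detH_eq_key :
    (QuotientGroup.mk (Units.mk0 (-(((356323 : ℚ) / 13698048))) (neg_ne_zero.2 (by norm_num))) : weilNormResidueGroup 7) =
      QuotientGroup.mk (Units.mk0 (-(39 : ℚ)) (neg_ne_zero.2 (by norm_num))) :=
  mk_neg_eq_mk_neg_of_mul_mem (by norm_num) (by norm_num)
    (mem_normUnitsSubgroup_of_sq_add_mul_sq _ ((-141 : ℚ) / 224) ((-233 : ℚ) / 784) (by norm_num))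

/-- FIBRE-PRODUCT datum `L27cxS51` `(0; 2:2^23.1^5,3:3^17,7a:7^7.2)` (cycle types in `S51`; Hurwitz dimension 0; CONSTRUCTED by depth-first search on planar hypermaps of the prescribed type (`planmap.py`; the random search fails on near-regular cycle types), then certified: generation: 2-transitive + Jordan (a 2-cycle as the 7-th power of a branch cycle, 2 <= n-3) => monodromy >= A_51): `Y = D ×_{ℙ¹} X` (genus 39; `D` the `L27c`-quotient datum = the `H₁`-quotient of the `L27c`-curve `C̃/S51`, `X` the degree-51 cover, genus 0), computed on its 2856 sheets (engine `bigwin.py` with the sparse cohomology `fastcover.py`, exact); the HIDDEN FACTOR `B` = the `λ`-part of the Prym `P(Y/D)` — an abelian SIXFOLD with `(3,3)` `ℚ(√-7)`-action, WEIL TYPE — has literal `det H|_B = -967/279888`, `a = 967/279888`, `T(a) = [3, 17]`: row `W6.7.51` (NON-split); `r₁ = dim_K H¹(D)_λ = 1`, `r_H = 7`. THEOREM S8 (Prym form of the product-window law, census b04.15 (A): `[a_B] = [n]^{r₁}`, no 2-transitivity needed) predicts `T(a_B) = [3, 17]` from `r₁ = 1`, `n = 51` — CONFIRMED.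
research route conditional on HC_CM; not a corollary; Q11.4-sentence-2 already refuted in dim ≥ 3. [cite: vanGeemen1994HodgeAV, (5.4.1)] -/
theorem fibre7_L27cS51_n51_f14ddf_mk_detH_ne_split :
    (QuotientGroup.mk (Units.mk0 (((-967 : ℚ) / 279888)) (by norm_num)) : weilNormResidueGroup 7) ≠
      splitDiscriminantClass 3 7 := by
  have e : Units.mk0 (((-967 : ℚ) / 279888)) (by norm_num) = -(Units.mk0 ((967 : ℚ) / 279888) (by norm_num)) := Units.ext (by norm_num)
  rw [Ne, e, mk_neg_eq_splitDiscriminantClass_iff_of_odd (n := 3) (by decide)]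
  have h := mul_not_mem_normUnitsSubgroup (mem_normUnitsSubgroup_of_sq_add_mul_sq (d := 7) (a := ((967 : ℚ) / 14274288)) (by norm_num) ((-3 : ℚ) / 476) ((5 : ℚ) / 2499) (by norm_num))
    Summit.HodgeConjecture.HodgeConjecture.Ring2.WeilCoverage.SqrtNeg7.not_mem_51
  rw [mk0_mul_mk0] at h
  norm_num at h
  exact h

/-- The same datum, CELL IDENTIFICATION: `[det H|_B] = [-51]` in `ℚˣ/Nm(ℚ(√-7)ˣ)` — the census ROW KEY of `W6.7.51` (`a·51 = ((967 : ℚ) / 5488) = (((-9 : ℚ) / 28))² + 7·(((5 : ℚ) / 49))²`).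
research route conditional on HC_CM; not a corollary; Q11.4-sentence-2 already refuted in dim ≥ 3. [cite: vanGeemen1994HodgeAV, Lemma 5.2 (3)] -/
theorem fibre7_L27cS51_n51_f14ddf_mk_detH_eq_key :
    (QuotientGroup.mk (Units.mk0 (-(((967 : ℚ) / 279888))) (neg_ne_zero.2 (by norm_num))) : weilNormResidueGroup 7) =
      QuotientGroup.mk (Units.mk0 (-(51 : ℚ)) (neg_ne_zero.2 (by norm_num))) :=
  mk_neg_eq_mk_neg_of_mul_mem (by norm_num) (by norm_num)
    (mem_normUnitsSubgroup_of_sq_add_mul_sq _ ((-9 : ℚ) / 28) ((5 : ℚ) / 49) (by norm_num))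

/-- FIBRE-PRODUCT datum `L27cxS51` `(0; 2:2^24.1^3,3:3^16.2.1,7a:7^7.2)` (cycle types in `S51`; Hurwitz dimension 0; CONSTRUCTED by depth-first search on planar hypermaps of the prescribed type (`planmap.py`; the random search fails on near-regular cycle types), then certified: generation: 2-transitive + Jordan (a 2-cycle as the 3-th power of a branch cycle, 2 <= n-3) => monodromy >= A_51): `Y = D ×_{ℙ¹} X` (genus 47; `D` the `L27c`-quotient datum = the `H₁`-quotient of the `L27c`-curve `C̃/S51`, `X` the degree-51 cover, genus 0), computed on its 2856 sheets (engine `bigwin.py` with the sparse cohomology `fastcover.py`, exact); the HIDDEN FACTOR `B` = the `λ`-part of the Prym `P(Y/D)` — an abelian SIXFOLD with `(3,3)` `ℚ(√-7)`-action, WEIL TYPE — has literal `det H|_B = -53/39984`, `a = 53/39984`, `T(a) = [3, 17]`: row `W6.7.51` (NON-split); `r₁ = dim_K H¹(D)_λ = 1`, `r_H = 7`. THEOREM S8 (Prym form of the product-window law, census b04.15 (A): `[a_B] = [n]^{r₁}`, no 2-transitivity needed) predicts `T(a_B) = [3, 17]` from `r₁ = 1`, `n = 51` — CONFIRMED.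
research route conditional on HC_CM; not a corollary; Q11.4-sentence-2 already refuted in dim ≥ 3. [cite: vanGeemen1994HodgeAV, (5.4.1)] -/
theorem fibre7_L27cS51_n51_6bd98f_mk_detH_ne_split :
    (QuotientGroup.mk (Units.mk0 (((-53 : ℚ) / 39984)) (by norm_num)) : weilNormResidueGroup 7) ≠
      splitDiscriminantClass 3 7 := by
  have e : Units.mk0 (((-53 : ℚ) / 39984)) (by norm_num) = -(Units.mk0 ((53 : ℚ) / 39984) (by norm_num)) := Units.ext (by norm_num)
  rw [Ne, e, mk_neg_eq_splitDiscriminantClass_iff_of_odd (n := 3) (by decide)]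
  have h := mul_not_mem_normUnitsSubgroup (mem_normUnitsSubgroup_of_sq_add_mul_sq (d := 7) (a := ((53 : ℚ) / 2039184)) (by norm_num) ((5 : ℚ) / 1428) ((1 : ℚ) / 714) (by norm_num))
    Summit.HodgeConjecture.HodgeConjecture.Ring2.WeilCoverage.SqrtNeg7.not_mem_51
  rw [mk0_mul_mk0] at h
  norm_num at h
  exact h

/-- The same datum, CELL IDENTIFICATION: `[det H|_B] = [-51]` in `ℚˣ/Nm(ℚ(√-7)ˣ)` — the census ROW KEY of `W6.7.51` (`a·51 = ((53 : ℚ) / 784) = (((5 : ℚ) / 28))² + 7·(((1 : ℚ) / 14))²`).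
research route conditional on HC_CM; not a corollary; Q11.4-sentence-2 already refuted in dim ≥ 3. [cite: vanGeemen1994HodgeAV, Lemma 5.2 (3)] -/
theorem fibre7_L27cS51_n51_6bd98f_mk_detH_eq_key :
    (QuotientGroup.mk (Units.mk0 (-(((53 : ℚ) / 39984))) (neg_ne_zero.2 (by norm_num))) : weilNormResidueGroup 7) =
      QuotientGroup.mk (Units.mk0 (-(51 : ℚ)) (neg_ne_zero.2 (by norm_num))) :=
  mk_neg_eq_mk_neg_of_mul_mem (by norm_num) (by norm_num)
    (mem_normUnitsSubgroup_of_sq_add_mul_sq _ ((5 : ℚ) / 28) ((1 : ℚ) / 14) (by norm_num))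

/-- FIBRE-PRODUCT datum `L27cxS51` `(0; 2:2^25.1,3:3^15.2^2.1^2,7a:7^7.2)` (cycle types in `S51`; Hurwitz dimension 0; CONSTRUCTED by depth-first search on planar hypermaps of the prescribed type (`planmap.py`; the random search fails on near-regular cycle types), then certified: generation: 2-transitive + Jordan (a 2-cycle as the 7-th power of a branch cycle, 2 <= n-3) => monodromy >= A_51): `Y = D ×_{ℙ¹} X` (genus 55; `D` the `L27c`-quotient datum = the `H₁`-quotient of the `L27c`-curve `C̃/S51`, `X` the degree-51 cover, genus 0), computed on its 2856 sheets (engine `bigwin.py` with the sparse cohomology `fastcover.py`, exact); the HIDDEN FACTOR `B` = the `λ`-part of the Prym `P(Y/D)` — an abelian SIXFOLD with `(3,3)` `ℚ(√-7)`-action, WEIL TYPE — has literal `det H|_B = -11289/11941888`, `a = 11289/11941888`, `T(a) = [3, 17]`: row `W6.7.51` (NON-split); `r₁ = dim_K H¹(D)_λ = 1`, `r_H = 7`. THEOREM S8 (Prym form of the product-window law, census b04.15 (A): `[a_B] = [n]^{r₁}`, no 2-transitivity needed) predicts `T(a_B) = [3, 17]` from `r₁ = 1`, `n = 51` — CONF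IRMED.
research route conditional on HC_CM; not a corollary; Q11.4-sentence-2 already refuted in dim ≥ 3. [cite: vanGeemen1994HodgeAV, (5.4.1)] -/
theorem fibre7_L27cS51_n51_c6eaf5_mk_detH_ne_split :
    (QuotientGroup.mk (Units.mk0 (((-11289 : ℚ) / 11941888)) (by norm_num)) : weilNormResidueGroup 7) ≠
      splitDiscriminantClass 3 7 := by
  have e : Units.mk0 (((-11289 : ℚ) / 11941888)) (by norm_num) = -(Units.mk0 ((11289 : ℚ) / 11941888) (by norm_num)) := Units.ext (by norm_num)
  rw [Ne, e, mk_neg_eq_splitDiscriminantClass_iff_of_odd (n := 3) (by decide)]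
  have h := mul_not_mem_normUnitsSubgroup (mem_normUnitsSubgroup_of_sq_add_mul_sq (d := 7) (a := ((3763 : ℚ) / 203012096)) (by norm_num) ((-47 : ℚ) / 15232) ((-121 : ℚ) / 106624) (by norm_num))
    Summit.HodgeConjecture.HodgeConjecture.Ring2.WeilCoverage.SqrtNeg7.not_mem_51
  rw [mk0_mul_mk0] at h
  norm_num at h
  exact h

/-- The same datum, CELL IDENTIFICATION: `[det H|_B] = [-51]` in `ℚˣ/Nm(ℚ(√-7)ˣ)` — the census ROW KEY of `W6.7.51` (`a·51 = ((33867 : ℚ) / 702464) = (((-141 : ℚ) / 896))² + 7·(((-363 : ℚ) / 6272))²`).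
research route conditional on HC_CM; not a corollary; Q11.4-sentence-2 already refuted in dim ≥ 3. [cite: vanGeemen1994HodgeAV, Lemma 5.2 (3)] -/
theorem fibre7_L27cS51_n51_c6eaf5_mk_detH_eq_key :
    (QuotientGroup.mk (Units.mk0 (-(((11289 : ℚ) / 11941888))) (neg_ne_zero.2 (by norm_num))) : weilNormResidueGroup 7) =
      QuotientGroup.mk (Units.mk0 (-(51 : ℚ)) (neg_ne_zero.2 (by norm_num))) :=
  mk_neg_eq_mk_neg_of_mul_mem (by norm_num) (by norm_num)
    (mem_normUnitsSubgroup_of_sq_add_mul_sq _ ((-141 : ℚ) / 896) ((-363 : ℚ) / 6272) (by norm_num))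

/-! ### §4 The uniform pillowcase polygons `n = 391` (`ℚ(√-3)`) and `n = 437` (`ℚ(i)`) -/

/-- PILLOWCASE datum (A₂ alcove lattice, orbifold `ℙ¹(3,3,3) = E_ω/C₃`): the double of the lattice 9-gon `P` with turning sequence `-1,-1,-1,+2,+1,+1,+1,+2,+2` (×60°) and side lengths `1,1,1,191,1,191,2,3,2` is a Belyi map `φ_P : ℙ¹ → ℙ¹` of degree `n = 391` (= number of alcoves of `P`) with passport `(4.3^128.2.1, 4^2.3^126.2^2.1, 3^130.1)` and monodromy group `A391` (certified: randomized Schreier–Sims lower bound = the full order); `Y_P : y³ = φ_P(φ_P − 1)` (genus 7) is the normalised fibre product `E ×_{ℙ¹} ℙ¹_{φ_P}` (1173 sheets over `ℙ¹`; engine `bigwin.py`, exact) and the HIDDEN FACTOR `B` = the `λ`-part of the Prym `P(Y_P/E)` — an abelian SIXFOLD with `(3,3)` `ℚ(√-3)`-action, WEIL TYPE — has literal `det H|_B = -64/391`, `a = 64/391`, `T(a) = [17, 23]`: row `W6.3.391` (NON-split); `r₁ = dim_K H¹(D)_λ = 1`, `r_H = 7`. THEOREM S8 (Prym form of the product-window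 law, census b04.15 (A): `[a_B] = [n]^{r₁}`, no 2-transitivity needed) predicts `T(a_B) = [17, 23]` from `r₁ = 1`, `n = 391` — CONFIRMED.
research route conditional on HC_CM; not a corollary; Q11.4-sentence-2 already refuted in dim ≥ 3. [cite: vanGeemen1994HodgeAV, (5.4.1)] -/
theorem pillow_C3A391_n391_8f48cd_mk_detH_ne_split :
    (QuotientGroup.mk (Units.mk0 (((-64 : ℚ) / 391)) (by norm_num)) : weilNormResidueGroup 3) ≠
      splitDiscriminantClass 3 3 := by
  have e : Units.mk0 (((-64 : ℚ) / 391)) (by norm_num) = -(Units.mk0 ((64 : ℚ) / 391) (by norm_num)) := Units.ext (by norm_num)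
  rw [Ne, e, mk_neg_eq_splitDiscriminantClass_iff_of_odd (n := 3) (by decide)]
  have h := mul_not_mem_normUnitsSubgroup (mem_normUnitsSubgroup_of_sq_add_mul_sq (d := 3) (a := ((64 : ℚ) / 152881)) (by norm_num) ((8 : ℚ) / 391) (0 : ℚ) (by norm_num))
    SqrtNeg3.not_mem_391
  rw [mk0_mul_mk0] at h
  norm_num at h
  exact h

/-- The same datum, CELL IDENTIFICATION: `[det H|_B] = [-391]` in `ℚˣ/Nm(ℚ(√-3)ˣ)` — the census ROW KEY of `W6.3.391` (`a·391 = (64 : ℚ) = ((8 : ℚ))² + 3·((0 : ℚ))²`).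
research route conditional on HC_CM; not a corollary; Q11.4-sentence-2 already refuted in dim ≥ 3. [cite: vanGeemen1994HodgeAV, Lemma 5.2 (3)] -/
theorem pillow_C3A391_n391_8f48cd_mk_detH_eq_key :
    (QuotientGroup.mk (Units.mk0 (-(((64 : ℚ) / 391))) (neg_ne_zero.2 (by norm_num))) : weilNormResidueGroup 3) =
      QuotientGroup.mk (Units.mk0 (-(391 : ℚ)) (neg_ne_zero.2 (by norm_num))) :=
  mk_neg_eq_mk_neg_of_mul_mem (by norm_num) (by norm_num)
    (mem_normUnitsSubgroup_of_sq_add_mul_sq _ (8 : ℚ) (0 : ℚ) (by norm_num))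

/-- PILLOWCASE datum (B₂ alcove lattice, orbifold `ℙ¹(4,4,2) = E_i/C₄`): the double of the lattice 9-gon `P` with turning sequence `-2,+1,+3,-2,+2,+2,-1,+2,+3` (×45°) and side lengths `1,1,1,1,216,1,216,1,1` is a Belyi map `φ_P : ℙ¹ → ℙ¹` of degree `n = 437` (= number of alcoves of `P`) with passport `(5.4^107.2.1^2, 4^108.3.2, 3^2.2^215.1)` and monodromy group `S437` (certified: randomized Schreier–Sims lower bound = the full order); `Y_P : y⁴ = φ_P(φ_P − 1)` (genus 8) is the normalised fibre product `E ×_{ℙ¹} ℙ¹_{φ_P}` (1748 sheets over `ℙ¹`; engine `bigwin.py`, exact) and the HIDDEN FACTOR `B` = the `λ`-part of the Prym `P(Y_P/E)` — an abelian SIXFOLD with `(3,3)` `ℚ(√-1)`-action, WEIL TYPE — has literal `det H|_B = -1/437`, `a = 1/437`, `T(a) = [19, 23]`: row `W6.1.437` (NON-split); `r₁ = dim_K H¹(D)_λ = 1`, `r_H = 7`. THEOREM S8 (Prym form of the product-window law, census b04.15 (A): `[a_B] = [n]^{r₁}`, no 2-transitivity needed) predicts `T(a_B) = [19, 23]` from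 `r₁ = 1`, `n = 437` — CONFIRMED.
research route conditional on HC_CM; not a corollary; Q11.4-sentence-2 already refuted in dim ≥ 3. [cite: vanGeemen1994HodgeAV, (5.4.1)] -/
theorem pillow_C4S437_n437_f60f5b_mk_detH_ne_split :
    (QuotientGroup.mk (Units.mk0 (((-1 : ℚ) / 437)) (by norm_num)) : weilNormResidueGroup 1) ≠
      splitDiscriminantClass 3 1 := by
  have e : Units.mk0 (((-1 : ℚ) / 437)) (by norm_num) = -(Units.mk0 ((1 : ℚ) / 437) (by norm_num)) := Units.ext (by norm_num)
  rw [Ne, e, mk_neg_eq_splitDiscriminantClass_iff_of_odd (n := 3) (by decide)]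
  have h := mul_not_mem_normUnitsSubgroup (mem_normUnitsSubgroup_of_sq_add_mul_sq (d := 1) (a := ((1 : ℚ) / 190969)) (by norm_num) ((1 : ℚ) / 437) (0 : ℚ) (by norm_num))
    SqrtNeg1.not_mem_437
  rw [mk0_mul_mk0] at h
  norm_num at h
  exact h

/-- The same datum, CELL IDENTIFICATION: `[det H|_B] = [-437]` in `ℚˣ/Nm(ℚ(√-1)ˣ)` — the census ROW KEY of `W6.1.437` (`a·437 = (1 : ℚ) = ((1 : ℚ))² + 1·((0 : ℚ))²`).
research route conditional on HC_CM; not a corollary; Q11.4-sentence-2 already refuted in dim ≥ 3. [cite: vanGeemen1994HodgeAV, Lemma 5.2 (3)] -/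
theorem pillow_C4S437_n437_f60f5b_mk_detH_eq_key :
    (QuotientGroup.mk (Units.mk0 (-(((1 : ℚ) / 437))) (neg_ne_zero.2 (by norm_num))) : weilNormResidueGroup 1) =
      QuotientGroup.mk (Units.mk0 (-(437 : ℚ)) (neg_ne_zero.2 (by norm_num))) :=
  mk_neg_eq_mk_neg_of_mul_mem (by norm_num) (by norm_num)
    (mem_normUnitsSubgroup_of_sq_add_mul_sq _ (1 : ℚ) (0 : ℚ) (by norm_num))

end Summit.HodgeConjecture.HodgeConjecture.Ring2.WeilCoverage
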